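import Summits.ResolutionOfSingularities.ResolutionOfSingularities.Theorems.ValuativeLuAlphaPTorsorResidualChartHelpers

/-!
# The residual chart of an adapted chart — transfer through the residue map

Crux `Valuative.LuAlphaPTorsor` (stmt-ResolutionOfSingularities-0641), line
`pfaff-line-log-final-forms`, stub `stub_residualChart` (F⁴ᵇ of reshape v6.2–v6.3). Setting: a
valuation ring `O` of `K`, a subring `S ⊆ O` with parameters `x₁, …, xₙ ∈ S` carrying levels
`lv`, a level `top`, and a coarsening `W ⊇ O` given by the membership characterization
`z ∈ W ↔ ν z ≤ ν(x^m)` for some `m` supported on the levels `< top` (the top coarsening of an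
adapted chart). With `π : W → κ(W)` the residue map, `Ō = O/𝔪_W ⊆ κ(W)`
(`residueValuationSubring`), `S̄ ⊆ κ(W)` any subring containing `π(S)` and consisting of residues
of elements of `S`, and `e` an enumeration of the parameters of level `< top`, this file proves:

* `residChart_residue_eq_zero_iff` — DICTIONARY (a): for `r ∈ S`, `π r = 0` iff `r` lies in the
  ideal of `S` generated by the parameters of level `top` (from clause (C3) at level `top`);
* `residChart_span_push` / `residChart_span_lift` — the ideal of `S̄` generated by the residues
  of the lower parameters of level `≥ ℓ` is the image of the ideal of `S` generated by the
  parameters of level `≥ ℓ`;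
* the clauses of an adapted chart for `(Ō, S̄, x̄ ∘ e, lv ∘ e)` from those of `(O, S, x, lv)`:
  centre (`residChart_span_eq_centre`) and (C3) (`residChart_C3`) — the value clauses being in
  `…ResidualChartValues` —, each a transfer of (in)equalities between Laurent monomials in the
  `W`-units `x_{<top}` through the dictionary of `…ResidualChartHelpers`.

No definition of the adapted-chart layer is used here: the clauses are spelled out, so that the
assembling file `…ResidualChart.lean` only unfolds `AdaptedChart` / `AdaptedValues`. [folklore]
-/

set_option linter.dupNamespace false

noncomputable section

open IsLocalRing Literature.AlgebraicGeometry.Resolution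

namespace Summit.ResolutionOfSingularities.ResolutionOfSingularities.Theorems.PfaffLine


variable {K : Type} [Field K] (O W : ValuationSubring K) (hOW : O ≤ W) {n : ℕ}
  (S : Subring K) (hSO : S ≤ O.toSubring) (x : Fin n → K) (hxS : ∀ i, x i ∈ S)
  (lv : Fin n → ℕ) (top : ℕ)

/-- Membership in the centre `𝔪_A ∩ S'` of a subring `S'` of a valuation ring `A` is `ν_A < 1`.
[folklore] -/
theorem residChart_mem_centre_iff {F : Type} [Field F] (A : ValuationSubring F) (S' : Subring F)
    (h : S' ≤ A.toSubring) (s : S') :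
    s ∈ Ideal.comap (Subring.inclusion h) (maximalIdeal A) ↔ A.valuation (s : F) < 1 := by
  rw [Ideal.mem_comap]
  exact ValuationSubring.valuation_lt_one_iff A _

/-! ### Dictionary (a): the kernel of the residue map on `S` -/

/-- **Dictionary (a).** For `r ∈ S`: `π r = 0` in `κ(W)` iff `r` lies in the ideal of `S`
generated by the parameters of level `top` (clause (C3) at level `top` + the non-units of `W`).
[folklore] -/
theorem residChart_residue_eq_zero_iff (hx0 : ∀ i, x i ≠ 0) (htop : ∀ i, lv i ≤ top)
    (hW : ∀ z : K, z ∈ W ↔ ∃ m : Fin n → ℤ, (∀ j, top ≤ lv j → m j = 0) ∧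
      O.valuation z ≤ ∏ j, O.valuation (x j) ^ (m j))
    (hC3 : ∀ (ℓ : ℕ) (z : S), z ∈ Ideal.span (Set.range
        fun i : {i : Fin n // ℓ ≤ lv i} => (⟨x i.1, hxS i.1⟩ : S)) ↔
      ∀ m : Fin n → ℤ, (∀ j, ℓ ≤ lv j → m j = 0) →
        O.valuation (z : K) < ∏ j, O.valuation (x j) ^ (m j))
    (r : K) (hr : r ∈ S) :
    residue W ⟨r, hOW (hSO hr)⟩ = 0 ↔
      (⟨r, hr⟩ : S) ∈ Ideal.span (Set.range
        fun i : {i : Fin n // lv i = top} => (⟨x i.1, hxS i.1⟩ : S)) := by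
  rw [residue_eq_zero_iff, ValuationSubring.valuation_lt_one_iff,
    ← residChart_range_top_eq S x hxS lv top htop, hC3 top ⟨r, hr⟩]
  exact ap_valuation_lt_one_iff_forall O W x (fun m => ∀ j, top ≤ lv j → m j = 0) hx0
    (fun _ _ => rfl) (fun m hm j hj => by rw [Pi.neg_apply, hm j hj, neg_zero]) hW r

/-! ### Ideals generated by parameters of level `≥ ℓ`: push-forward and lift -/

section Spans

variable (Sb : Subring (ResidueField W))
  (h1 : ∀ (r : K) (hr : r ∈ S), residue W ⟨r, hOW (hSO hr)⟩ ∈ Sb)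

/-- **Push-forward.** The residue of an element of the ideal `(x_i : ℓ ≤ lv i)` of `S` lies in
the ideal `(x̄_j : ℓ ≤ lv (e j))` of `S̄` (the top parameters have residue `0`). [folklore] -/
theorem residChart_span_push (hx0 : ∀ i, x i ≠ 0) (htop : ∀ i, lv i ≤ top)
    (hW : ∀ z : K, z ∈ W ↔ ∃ m : Fin n → ℤ, (∀ j, top ≤ lv j → m j = 0) ∧
      O.valuation z ≤ ∏ j, O.valuation (x j) ^ (m j))
    (hC3 : ∀ (ℓ : ℕ) (z : S), z ∈ Ideal.span (Set.range
        fun i : {i : Fin n // ℓ ≤ lv i} => (⟨x i.1, hxS i.1⟩ : S)) ↔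
      ∀ m : Fin n → ℤ, (∀ j, ℓ ≤ lv j → m j = 0) →
        O.valuation (z : K) < ∏ j, O.valuation (x j) ^ (m j))
    {nS : ℕ} (e : Fin nS ≃ {i : Fin n // lv i < top}) (ℓ : ℕ) (z : K) (hz : z ∈ S)
    (hmem : (⟨z, hz⟩ : S) ∈ Ideal.span (Set.range
      fun i : {i : Fin n // ℓ ≤ lv i} => (⟨x i.1, hxS i.1⟩ : S))) :
    (⟨residue W ⟨z, hOW (hSO hz)⟩, h1 z hz⟩ : Sb) ∈
      Ideal.span (Set.range fun j : {j : Fin nS // ℓ ≤ lv (e j).1} =>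
        (⟨residue W ⟨x (e j.1).1, hOW (hSO (hxS (e j.1).1))⟩, h1 _ (hxS (e j.1).1)⟩ : Sb)) := by
  have hSW : S ≤ W.toSubring := fun z hz => hOW (hSO hz)
  let φ : S →+* Sb := ((residue W).comp (Subring.inclusion hSW)).codRestrict Sb
    fun s => h1 s s.2
  have hφ : ∀ (r : K) (hr : r ∈ S), φ ⟨r, hr⟩ = ⟨residue W ⟨r, hOW (hSO hr)⟩, h1 r hr⟩ :=
    fun r hr => rfl
  rw [Ideal.mem_span_range_iff_exists_fun] at hmem
  obtain ⟨c, hc⟩ := hmem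
  rw [← hφ z hz, ← hc, map_sum]
  refine sum_mem fun i _ => ?_
  rw [map_mul]
  refine Ideal.mul_mem_left _ _ ?_
  rcases (htop i.1).lt_or_eq with hlt | heq
  · -- a lower parameter: its residue is one of the generators
    set j := e.symm ⟨i.1, hlt⟩ with hj
    have hej : e j = ⟨i.1, hlt⟩ := e.apply_symm_apply _
    refine Ideal.subset_span ⟨⟨j, by rw [hej]; exact i.2⟩, ?_⟩
    rw [hφ]
    apply Subtype.ext
    change residue W _ = residue W _
    congr 2
    rw [hej]
  · -- a top parameter: its residue vanishes
    have h0 : φ ⟨x i.1, hxS i.1⟩ = 0 := by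
      rw [hφ]
      apply Subtype.ext
      exact (residChart_residue_eq_zero_iff O W hOW S hSO x hxS lv top hx0 htop hW hC3 _ _).mpr
        (Ideal.subset_span ⟨⟨i.1, heq⟩, rfl⟩)
    rw [h0]
    exact Ideal.zero_mem _

/-- **Lift.** Every element of the ideal `(x̄_j : ℓ ≤ lv (e j))` of `S̄` is the residue of an
element of the ideal `(x_i : ℓ ≤ lv i)` of `S` (residues of `S` exhaust `S̄`). [folklore] -/
theorem residChart_span_lift
    (h2 : ∀ rb ∈ Sb, ∃ (r : K) (hr : r ∈ S), residue W ⟨r, hOW (hSO hr)⟩ = rb)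
    {nS : ℕ} (e : Fin nS ≃ {i : Fin n // lv i < top}) (ℓ : ℕ) (zb : Sb)
    (hzb : zb ∈ Ideal.span (Set.range fun j : {j : Fin nS // ℓ ≤ lv (e j).1} =>
        (⟨residue W ⟨x (e j.1).1, hOW (hSO (hxS (e j.1).1))⟩, h1 _ (hxS (e j.1).1)⟩ : Sb))) :
    ∃ (z : K) (hz : z ∈ S), (⟨z, hz⟩ : S) ∈ Ideal.span (Set.range
        fun i : {i : Fin n // ℓ ≤ lv i} => (⟨x i.1, hxS i.1⟩ : S)) ∧
      residue W ⟨z, hOW (hSO hz)⟩ = zb := by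
  induction hzb using Submodule.span_induction with
  | mem v hv =>
    obtain ⟨⟨j, hj⟩, rfl⟩ := hv
    exact ⟨x (e j).1, hxS _, Ideal.subset_span ⟨⟨(e j).1, hj⟩, rfl⟩, rfl⟩
  | zero => exact ⟨0, S.zero_mem, Ideal.zero_mem _, map_zero (residue W)⟩
  | add v w _ _ ihv ihw =>
    obtain ⟨z, hz, hzm, hzv⟩ := ihv
    obtain ⟨z', hz', hz'm, hz'v⟩ := ihw
    refine ⟨z + z', S.add_mem hz hz', Ideal.add_mem _ hzm hz'm, ?_⟩
    rw [Subring.coe_add, ← hzv, ← hz'v, ← map_add]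
    rfl
  | smul a v _ ihv =>
    obtain ⟨z, hz, hzm, hzv⟩ := ihv
    obtain ⟨r, hr, hra⟩ := h2 a a.2
    refine ⟨r * z, S.mul_mem hr hz, Ideal.mul_mem_left _ ⟨r, hr⟩ hzm, ?_⟩
    rw [smul_eq_mul, Subring.coe_mul, ← hra, ← hzv, ← map_mul]
    rfl

end Spans

/-! ### The clauses of the residual chart -/

section Clauses

variable (Sb : Subring (ResidueField W))
  (hSb : Sb ≤ (residueValuationSubring O W hOW).toSubring)
  (h1 : ∀ (r : K) (hr : r ∈ S), residue W ⟨r, hOW (hSO hr)⟩ ∈ Sb)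
  (h2 : ∀ rb ∈ Sb, ∃ (r : K) (hr : r ∈ S), residue W ⟨r, hOW (hSO hr)⟩ = rb)
  {nS : ℕ} (e : Fin nS ≃ {i : Fin n // lv i < top})

include h2 in
/-- **Centre of the residual chart.** The residues `x̄_j` of the lower parameters generate the
centre `𝔪_Ō ∩ S̄` of `Ō` on `S̄`. [folklore] -/
theorem residChart_span_eq_centre (hx0 : ∀ i, x i ≠ 0) (htop : ∀ i, lv i ≤ top)
    (hW : ∀ z : K, z ∈ W ↔ ∃ m : Fin n → ℤ, (∀ j, top ≤ lv j → m j = 0) ∧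
      O.valuation z ≤ ∏ j, O.valuation (x j) ^ (m j))
    (hC3 : ∀ (ℓ : ℕ) (z : S), z ∈ Ideal.span (Set.range
        fun i : {i : Fin n // ℓ ≤ lv i} => (⟨x i.1, hxS i.1⟩ : S)) ↔
      ∀ m : Fin n → ℤ, (∀ j, ℓ ≤ lv j → m j = 0) →
        O.valuation (z : K) < ∏ j, O.valuation (x j) ^ (m j))
    (hspan : Ideal.span (Set.range fun i => (⟨x i, hxS i⟩ : S)) =
      Ideal.comap (Subring.inclusion hSO) (maximalIdeal O)) :
    Ideal.span (Set.range fun j : Fin nS =>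
        (⟨residue W ⟨x (e j).1, hOW (hSO (hxS (e j).1))⟩, h1 _ (hxS (e j).1)⟩ : Sb)) =
      Ideal.comap (Subring.inclusion hSb) (maximalIdeal (residueValuationSubring O W hOW)) := by
  have hy1 : ∀ j : Fin nS, W.valuation (x (e j).1) = 1 := fun j =>
    residChart_val_param_eq_one O W x lv top hx0 hW _ (e j).2
  have hone : residue W ⟨(1 : K), W.one_mem⟩ = 1 := map_one (residue W)
  apply le_antisymm
  · rw [Ideal.span_le]
    rintro _ ⟨j, rfl⟩
    rw [SetLike.mem_coe, residChart_mem_centre_iff]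
    have hlt : O.valuation (x (e j).1) < O.valuation 1 := by
      rw [map_one, ← residChart_mem_centre_iff O S hSO ⟨x (e j).1, hxS _⟩, ← hspan]
      exact Ideal.subset_span ⟨(e j).1, rfl⟩
    have := (ap_resval_lt_iff O W hOW (hOW (hSO (hxS (e j).1))) W.one_mem
      (hy1 j)).mpr hlt
    rwa [hone, map_one] at this
  · intro zb hzb
    rw [residChart_mem_centre_iff] at hzb
    obtain ⟨r, hr, hrz⟩ := h2 zb zb.2
    have hzb' : zb = ⟨residue W ⟨r, hOW (hSO hr)⟩, h1 r hr⟩ := Subtype.ext hrz.symm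
    subst hzb'
    by_cases hres : residue W ⟨r, hOW (hSO hr)⟩ = 0
    · have : (⟨residue W ⟨r, hOW (hSO hr)⟩, h1 r hr⟩ : Sb) = 0 := Subtype.ext hres
      rw [this]
      exact Ideal.zero_mem _
    · have h1r := residChart_val_eq_one_of_residue_ne_zero W _ hres
      have hlt : O.valuation r < 1 := by
        have := (ap_resval_lt_iff O W hOW (hOW (hSO hr)) W.one_mem h1r).mp
          (by rw [hone, map_one]; exact hzb)
        rwa [map_one] at this
      have hmem : (⟨r, hr⟩ : S) ∈ Ideal.span (Set.range
          fun i : {i : Fin n // 0 ≤ lv i} => (⟨x i.1, hxS i.1⟩ : S)) := by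
        have h0 : (⟨r, hr⟩ : S) ∈ Ideal.span (Set.range fun i => (⟨x i, hxS i⟩ : S)) := by
          rw [hspan, residChart_mem_centre_iff]
          exact hlt
        refine Ideal.span_mono ?_ h0
        rintro _ ⟨i, rfl⟩
        exact ⟨⟨i, Nat.zero_le _⟩, rfl⟩
      refine Ideal.span_mono ?_
        (residChart_span_push O W hOW S hSO x hxS lv top Sb h1 hx0 htop hW hC3 e 0 r hr hmem)
      rintro _ ⟨⟨j, -⟩, rfl⟩
      exact ⟨j, rfl⟩

include h2 in
/-- **(C3) for the residual chart.** For every level `ℓ`, the ideal of `S̄` generated by the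
`x̄_j` of level `≥ ℓ` is the set of elements of `S̄` of `ν̄`-value below every Laurent monomial in
the `x̄_j` of level `< ℓ`. [folklore] -/
theorem residChart_C3 (hx0 : ∀ i, x i ≠ 0) (htop : ∀ i, lv i ≤ top)
    (hW : ∀ z : K, z ∈ W ↔ ∃ m : Fin n → ℤ, (∀ j, top ≤ lv j → m j = 0) ∧
      O.valuation z ≤ ∏ j, O.valuation (x j) ^ (m j))
    (hC3 : ∀ (ℓ : ℕ) (z : S), z ∈ Ideal.span (Set.range
        fun i : {i : Fin n // ℓ ≤ lv i} => (⟨x i.1, hxS i.1⟩ : S)) ↔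
      ∀ m : Fin n → ℤ, (∀ j, ℓ ≤ lv j → m j = 0) →
        O.valuation (z : K) < ∏ j, O.valuation (x j) ^ (m j))
    (ℓ : ℕ) (zb : Sb) :
    zb ∈ Ideal.span (Set.range fun j : {j : Fin nS // ℓ ≤ lv (e j).1} =>
        (⟨residue W ⟨x (e j.1).1, hOW (hSO (hxS (e j.1).1))⟩, h1 _ (hxS (e j.1).1)⟩ : Sb)) ↔
      ∀ m : Fin nS → ℤ, (∀ j, ℓ ≤ lv (e j).1 → m j = 0) →
        (residueValuationSubring O W hOW).valuation (zb : ResidueField W) <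
          ∏ j, (residueValuationSubring O W hOW).valuation
            (residue W ⟨x (e j).1, hOW (hSO (hxS (e j).1))⟩) ^ (m j) := by
  classical
  have hy1 : ∀ j : Fin nS, W.valuation (x (e j).1) = 1 := fun j =>
    residChart_val_param_eq_one O W x lv top hx0 hW _ (e j).2
  -- the right-hand side holds for `zb = 0`
  have hpos : ∀ m : Fin nS → ℤ, (0 : (residueValuationSubring O W hOW).ValueGroup) <
      ∏ j, (residueValuationSubring O W hOW).valuation
        (residue W ⟨x (e j).1, hOW (hSO (hxS (e j).1))⟩) ^ (m j) := fun m =>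
    residChart_prod_zpow_pos _ (fun j => (Valuation.ne_zero_iff _).mpr
      (ap_residue_ne_zero_of_valuation_eq_one W _ (hy1 j))) m
  -- products of residual values are residual values of products
  have hprod : ∀ m : Fin nS → ℤ,
      (∏ j, (residueValuationSubring O W hOW).valuation
        (residue W ⟨x (e j).1, hOW (hSO (hxS (e j).1))⟩) ^ (m j)) =
      (residueValuationSubring O W hOW).valuation (residue W ⟨∏ j, x (e j).1 ^ (m j),
        residChart_mem_of_val_one W
          (residChart_val_prod_zpow_eq_one W (fun l => x (e l).1) hy1 m)⟩) := fun m =>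
    (residChart_val_residue_prod_zpow W (fun l => x (e l).1) hy1 _ m _).symm
  constructor
  · intro hzb m hm
    obtain ⟨z, hz, hzm, hzv⟩ :=
      residChart_span_lift O W hOW S hSO x hxS lv top Sb h1 h2 e ℓ zb hzb
    rw [← hzv]
    by_cases hres : residue W ⟨z, hOW (hSO hz)⟩ = 0
    · rw [hres, map_zero]
      exact hpos m
    · have h1z := residChart_val_eq_one_of_residue_ne_zero W _ hres
      rw [hprod, ap_resval_lt_iff O W hOW _ _ h1z, map_prod]
      have key := (hC3 ℓ ⟨z, hz⟩).mp hzm (Function.extend (fun l => (e l).1) m 0)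
        (residChart_extend_eq_zero e m (fun i => ℓ ≤ lv i) hm)
      rw [residChart_prod_extend e (fun i => O.valuation (x i)) m] at key
      convert key using 2 with j
      exact map_zpow₀ _ _ _
  · intro h
    obtain ⟨z, hz, hzv⟩ := h2 zb zb.2
    have hzb' : zb = ⟨residue W ⟨z, hOW (hSO hz)⟩, h1 z hz⟩ := Subtype.ext hzv.symm
    subst hzb'
    by_cases hres : residue W ⟨z, hOW (hSO hz)⟩ = 0
    · have : (⟨residue W ⟨z, hOW (hSO hz)⟩, h1 z hz⟩ : Sb) = 0 := Subtype.ext hres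
      rw [this]
      exact Ideal.zero_mem _
    · have h1z := residChart_val_eq_one_of_residue_ne_zero W _ hres
      -- transfer the hypothesis to `O`-values of `z` against the lower monomials
      have h' : ∀ m : Fin nS → ℤ, (∀ j, ℓ ≤ lv (e j).1 → m j = 0) →
          O.valuation z < ∏ j, O.valuation (x (e j).1) ^ (m j) := by
        intro m hm
        have := h m hm
        rw [hprod] at this
        have := (ap_resval_lt_iff O W hOW _ _ h1z).mp this
        rw [map_prod] at this
        convert this using 2 with j
        exact (map_zpow₀ _ _ _).symm
      rcases le_or_gt ℓ top with hℓ | hℓ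
      · -- `ℓ ≤ top`: exponents supported below `ℓ` are supported below `top`
        have hzm : (⟨z, hz⟩ : S) ∈ Ideal.span (Set.range
            fun i : {i : Fin n // ℓ ≤ lv i} => (⟨x i.1, hxS i.1⟩ : S)) := by
          rw [hC3]
          intro m hm
          have hmlow : ∀ i, ¬ lv i < top → m i = 0 := fun i hi =>
            hm i (hℓ.trans (not_lt.mp hi))
          rw [← residChart_extend_restrict e m hmlow,
            residChart_prod_extend e (fun i => O.valuation (x i))]
          exact h' _ fun j hj => hm (e j).1 hj
        exact residChart_span_push O W hOW S hSO x hxS lv top Sb h1 hx0 htop hW hC3 e ℓ z hz hzm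
      · -- `top < ℓ`: every lower exponent is admissible, so `z ∈ 𝔪_W`, contradiction
        exfalso
        apply hres
        rw [residChart_residue_eq_zero_iff O W hOW S hSO x hxS lv top hx0 htop hW hC3 z hz,
          ← residChart_range_top_eq S x hxS lv top htop, hC3]
        intro m hm
        have hmlow : ∀ i, ¬ lv i < top → m i = 0 := fun i hi => hm i (not_lt.mp hi)
        rw [← residChart_extend_restrict e m hmlow,
          residChart_prod_extend e (fun i => O.valuation (x i))]
        exact h' _ fun j hj => absurd ((e j).2.trans_le (hℓ.le.trans hj)) (lt_irrefl _)

end Clauses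


/-- **Dictionary (a)** (registered anchor of this helper file): for `r ∈ S`, `π r = 0` in `κ(W)`
iff `r` lies in the ideal of `S` generated by the parameters of level `top`. [folklore] -/
theorem residChart_dictionary_a : ∀ (K : Type) [Field K] (O W : ValuationSubring K) (hOW : O ≤ W) (n : ℕ) (S : Subring K) (hSO : S ≤ O.toSubring) (x : Fin n → K) (hxS : ∀ i, x i ∈ S) (lv : Fin n → ℕ) (top : ℕ), (∀ i, x i ≠ 0) → (∀ i, lv i ≤ top) → (∀ z : K, z ∈ W ↔ ∃ m : Fin n → ℤ, (∀ j, top ≤ lv j → m j = 0) ∧ O.valuation z ≤ ∏ j, O.valuation (x j) ^ (m j)) → (∀ (ℓ : ℕ) (z : S), z ∈ Ideal.span (Set.range fun i : {i : Fin n // ℓ ≤ lv i} => (⟨x i.1, hxS i.1⟩ : S)) ↔ ∀ m : Fin n → ℤ, (∀ j, ℓ ≤ lv j → m j = 0) → O.valuation (z : K) < ∏ j, O.valuation (x j) ^ (m j)) → ∀ (r : K) (hr : r ∈ S), IsLocalRing.residue W ⟨r, hOW (hSO hr)⟩ = 0 ↔ (⟨r, hr⟩ : S) ∈ Ideal.span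 (Set.range fun i : {i : Fin n // lv i = top} => (⟨x i.1, hxS i.1⟩ : S)) :=
  fun _ _ O W hOW _ S hSO x hxS lv top hx0 htop hW hC3 r hr =>
    residChart_residue_eq_zero_iff O W hOW S hSO x hxS lv top hx0 htop hW hC3 r hr

end Summit.ResolutionOfSingularities.ResolutionOfSingularities.Theorems.PfaffLine

end
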